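import Literature.NumberTheory.Transcendental.PhilipponZeroEstimate
import Mathlib.Analysis.Fourier.FiniteAbelian.PontryaginDuality
import Mathlib.LinearAlgebra.FreeModule.Int
import Mathlib.FieldTheory.IsAlgClosed.Basic
import Mathlib.Analysis.Complex.Polynomial.Basic
import HarnessLib

/-!
# Torsion points of a subtorus: `#T_B = [ℤⁿ : B]`

Topic `Literature/NumberTheory/Transcendental`. For a subgroup `B ≤ ℤⁿ = X(𝔾ₘⁿ)` of characters,
the common kernel `T_B = {y ∈ (ℂˣ)ⁿ ; y^χ = 1 for all χ ∈ B}` has exactly `[ℤⁿ : B]` points, with the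
convention (`Nat.card`, `AddSubgroup.index`) that both sides are `0` when infinite
(`GaGm.natCard_torsion_eq_index`). This is the character duality of diagonalizable groups
(Borel, *Linear Algebraic Groups*, §8.5, Prop. 8.12: `T_B ≅ Hom(ℤⁿ/B, 𝔾ₘ)`); for finite `ℤⁿ/B` the
count is Pontryagin duality `#Hom(F, ℂˣ) = #F` (Mathlib `AddChar.card_eq`), and for infinite `ℤⁿ/B`
a coordinate functional of a Smith normal form of `B` produces a cocharacter `t ↦ (t^{v_j})` inside
`T_B`. In the tree it converts the slice counts `#(T_A ∩ T_{ℤ^J})` of `GaGmSubgroupMultBound.lean`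
into lattice indices `[ℤⁿ : A + ℤ^J]`, i.e. into the maximal minors `|det M_{Jᶜ}|` of
Nesterenko 2003, (5.7). Everything here is PROVED.

## References

* A. Borel, *Linear Algebraic Groups*, GTM 126 (1991), §8.5, Prop. 8.12. [Borel1991]
* Yu. V. Nesterenko, *Linear forms in logarithms of rational numbers*, LNM 1819 (2003), §5.1 (5.7).
  [Nesterenko2003]
-/

noncomputable section

open Module

namespace Literature.NumberTheory.Transcendental

namespace GaGm

variable {n : ℕ}

/-! ### The pairing `(y, χ) ↦ y^χ = ∏ⱼ yⱼ^{χⱼ}` -/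

/-- `y^{χ+χ'} = y^χ · y^{χ'}`. [cite: Borel1991, §8.5] -/
theorem prod_zpow_add (y : Fin n → ℂˣ) (χ χ' : Fin n → ℤ) :
    ∏ j, y j ^ (χ + χ') j = (∏ j, y j ^ χ j) * ∏ j, y j ^ χ' j := by
  rw [← Finset.prod_mul_distrib]
  exact Finset.prod_congr rfl fun j _ => by rw [Pi.add_apply, zpow_add]

/-- `y^{e_j} = y_j`. [cite: Borel1991, §8.5] -/
theorem prod_zpow_single (y : Fin n → ℂˣ) (j : Fin n) :
    ∏ i, y i ^ (Pi.single j (1 : ℤ) : Fin n → ℤ) i = y j := by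
  rw [Finset.prod_eq_single j (fun i _ hi => by rw [Pi.single_eq_of_ne hi, zpow_zero])
    (fun h => absurd (Finset.mem_univ j) h), Pi.single_eq_same, zpow_one]

/-- The character `χ ↦ y^χ` of `ℤⁿ` attached to a torus point `y`, with values in `Additive ℂˣ`.
[cite: Borel1991, §8.5] -/
theorem exists_addMonoidHom_pairing (y : Fin n → ℂˣ) :
    ∃ f : (Fin n → ℤ) →+ Additive ℂˣ, ∀ χ, f χ = Additive.ofMul (∏ j, y j ^ χ j) :=
  ⟨AddMonoidHom.mk' (fun χ => Additive.ofMul (∏ j, y j ^ χ j)) fun χ χ' => by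
    rw [prod_zpow_add, ofMul_mul], fun _ => rfl⟩

/-! ### Complex characters of a quotient of `ℤⁿ` -/

/-- Values of a complex character of a group are non-zero. [cite: Borel1991, §8.5] -/
theorem addChar_apply_ne_zero {A : Type*} [AddCommGroup A] (ψ : AddChar A ℂ) (a : A) : ψ a ≠ 0 := by
  intro h
  have := AddChar.map_add_eq_mul ψ a (-a)
  rw [add_neg_cancel, AddChar.map_zero_eq_one, h, zero_mul] at this
  exact one_ne_zero this

/-- A complex character of `ℤⁿ/B` is determined by its values on the images of the unit vectors:
`ψ(χ mod B) = ∏ⱼ ψ(eⱼ mod B)^{χⱼ}`. [cite: Borel1991, §8.5] -/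
theorem addChar_apply_mk (B : AddSubgroup (Fin n → ℤ)) (ψ : AddChar ((Fin n → ℤ) ⧸ B) ℂ)
    (χ : Fin n → ℤ) :
    ψ (QuotientAddGroup.mk χ) = ∏ j, ψ (QuotientAddGroup.mk (Pi.single j (1 : ℤ))) ^ χ j := by
  have hχ : χ = ∑ j, χ j • (Pi.single j (1 : ℤ) : Fin n → ℤ) := by
    conv_lhs => rw [pi_eq_sum_univ χ]
    refine Finset.sum_congr rfl fun j _ => ?_
    funext i
    simp only [Pi.smul_apply, smul_eq_mul, Pi.single_apply]
    by_cases h : i = j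
    · subst h; simp
    · rw [if_neg h, if_neg (Ne.symm h)]
  conv_lhs => rw [hχ]
  rw [QuotientAddGroup.mk_sum]
  -- through the monoid hom `Multiplicative (ℤⁿ/B) →* ℂ`
  have h := map_prod ψ.toMonoidHom (fun j => Multiplicative.ofAdd
    (QuotientAddGroup.mk (χ j • (Pi.single j (1 : ℤ) : Fin n → ℤ)) : (Fin n → ℤ) ⧸ B)) Finset.univ
  rw [← ofAdd_sum] at h
  simp only [AddChar.toMonoidHom_apply, toAdd_ofAdd] at h
  rw [h]
  refine Finset.prod_congr rfl fun j _ => ?_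
  rw [QuotientAddGroup.mk_zsmul, AddChar.map_zsmul_eq_zpow]

/-! ### The finite case: Pontryagin duality -/

/-- **Finite case.** If `B ≤ ℤⁿ` has finite index then `T_B = {y ; y^χ = 1 ∀ χ ∈ B}` has exactly
`[ℤⁿ : B]` points: `T_B` is in bijection with the complex characters of `ℤⁿ/B`
(`y ↦ (χ ↦ y^χ)`), whose number is `#(ℤⁿ/B)` by Pontryagin duality. [cite: Borel1991, §8.5 Prop. 8.12] -/
theorem natCard_torsion_eq_index_of_ne_zero (B : AddSubgroup (Fin n → ℤ)) (hB : B.index ≠ 0) :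
    Nat.card {y : Fin n → ℂˣ // ∀ χ ∈ B, ∏ j, y j ^ χ j = 1} = B.index := by
  classical
  haveI : B.FiniteIndex := ⟨hB⟩
  haveI : Finite ((Fin n → ℤ) ⧸ B) := AddSubgroup.finite_quotient_of_finiteIndex
  letI : Fintype ((Fin n → ℤ) ⧸ B) := Fintype.ofFinite _
  set Q := (Fin n → ℤ) ⧸ B with hQ
  -- the character attached to a point of `T_B`
  have hlift : ∀ y : {y : Fin n → ℂˣ // ∀ χ ∈ B, ∏ j, y j ^ χ j = 1},
      ∃ g : Q →+ Additive ℂˣ, ∀ χ, g (QuotientAddGroup.mk χ) = Additive.ofMul (∏ j, (y : Fin n → ℂˣ) j ^ χ j) := by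
    intro y
    obtain ⟨f, hf⟩ := exists_addMonoidHom_pairing (y : Fin n → ℂˣ)
    have hker : B ≤ f.ker := fun χ hχ => by
      rw [AddMonoidHom.mem_ker, hf, y.2 χ hχ, ofMul_one]
    exact ⟨QuotientAddGroup.lift B f hker, fun χ => by rw [QuotientAddGroup.lift_mk, hf]⟩
  choose g hg using hlift
  let toChar : {y : Fin n → ℂˣ // ∀ χ ∈ B, ∏ j, y j ^ χ j = 1} → AddChar Q ℂ := fun y =>
    { toFun := fun q => ((Additive.toMul (g y q) : ℂˣ) : ℂ)
      map_zero_eq_one' := by rw [map_zero, toMul_zero, Units.val_one]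
      map_add_eq_mul' := fun a b => by rw [map_add, toMul_add, Units.val_mul] }
  have htoChar : ∀ y χ, toChar y (QuotientAddGroup.mk χ) = ((∏ j, (y : Fin n → ℂˣ) j ^ χ j : ℂˣ) : ℂ) := by
    intro y χ
    change ((Additive.toMul (g y (QuotientAddGroup.mk χ)) : ℂˣ) : ℂ) = _
    rw [hg, toMul_ofMul]
  -- the point attached to a character
  let ofChar : AddChar Q ℂ → {y : Fin n → ℂˣ // ∀ χ ∈ B, ∏ j, y j ^ χ j = 1} := fun ψ =>
    ⟨fun j => Units.mk0 (ψ (QuotientAddGroup.mk (Pi.single j (1 : ℤ)))) (addChar_apply_ne_zero ψ _),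
      fun χ hχ => by
        apply Units.val_injective
        rw [Units.val_one, Units.coe_prod]
        simp only [Units.val_zpow_eq_zpow_val, Units.val_mk0]
        rw [← addChar_apply_mk, (QuotientAddGroup.eq_zero_iff χ).mpr hχ, AddChar.map_zero_eq_one]⟩
  have hbij : Function.Bijective toChar := by
    refine Function.bijective_iff_has_inverse.mpr ⟨ofChar, fun y => ?_, fun ψ => ?_⟩
    · apply Subtype.ext
      funext j
      apply Units.val_injective
      change ((toChar y) (QuotientAddGroup.mk (Pi.single j (1 : ℤ))) : ℂ) = _
      rw [htoChar, prod_zpow_single]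
    · ext q
      induction q using QuotientAddGroup.induction_on with
      | H χ =>
        rw [htoChar, addChar_apply_mk B ψ χ, Units.coe_prod]
        simp only [Units.val_zpow_eq_zpow_val]
        rfl
  rw [Nat.card_eq_of_bijective toChar hbij, Nat.card_eq_fintype_card, AddChar.card_eq,
    ← Nat.card_eq_fintype_card, AddSubgroup.index]

/-! ### The infinite case: a cocharacter in `T_B` -/

/-- `∏ᵢ a^{f i} = a^{∑ᵢ f i}` in a commutative group (private copy of a folklore lemma landed in
an unrelated corner of the tree, `Literature.Topology.FourManifolds.prod_zpow_eq_zpow_sum`). [folklore] -/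
private theorem prod_zpow_eq_zpow_sum {ι G : Type*} [CommGroup G] (s : Finset ι) (f : ι → ℤ) (a : G) :
    ∏ i ∈ s, a ^ f i = a ^ ∑ i ∈ s, f i := by
  classical
  induction s using Finset.induction_on with
  | empty => simp
  | insert i s hi ih => rw [Finset.prod_insert hi, Finset.sum_insert hi, ih, zpow_add]

/-- `ℂˣ` is infinite (private copy of a folklore lemma landed in an unrelated corner of the tree,
`…Arthur2013.Leaves.Sp4KlingenCoefficients.infinite_unitsC`). [folklore] -/
private theorem infinite_units_complex : Infinite ℂˣ :=
  Infinite.of_injective (fun k : ℕ => Units.mk0 ((k : ℂ) + 1) (Nat.cast_add_one_ne_zero k))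
    fun a b h => by
      have := congrArg Units.val h
      simp only [Units.val_mk0, add_left_inj, Nat.cast_inj] at this
      exact this

/-- A subgroup `B ≤ ℤⁿ` of infinite index is annihilated by a non-zero integer vector:
`∑ⱼ χⱼ vⱼ = 0` for all `χ ∈ B` (a coordinate functional of a Smith normal form of `B`).
[cite: Borel1991, §8.5] -/
theorem exists_annihilator_of_index_eq_zero (B : AddSubgroup (Fin n → ℤ)) (hB : B.index = 0) :
    ∃ v : Fin n → ℤ, v ≠ 0 ∧ ∀ χ ∈ B, ∑ j, χ j * v j = 0 := by
  classical
  set N : Submodule ℤ (Fin n → ℤ) := AddSubgroup.toIntSubmodule B with hN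
  obtain ⟨m, snf⟩ := N.smithNormalForm (Basis.ofEquivFun (LinearEquiv.refl ℤ (Fin n → ℤ)))
  have hidx : ¬ (N.toAddSubgroup.index ≠ 0) := by
    rw [hN, AddSubgroup.toIntSubmodule_toAddSubgroup, hB]; exact fun h => h rfl
  rw [snf.toAddSubgroup_index_ne_zero_iff, Fintype.card_fin] at hidx
  obtain ⟨bM, bN, f, a, hsnf⟩ := snf
  -- a coordinate not hit by `f`
  have hm : m ≤ n := by simpa using Fintype.card_le_of_embedding f
  obtain ⟨l, hl⟩ : ∃ l : Fin n, l ∉ Set.range f := by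
    by_contra hcon
    push Not at hcon
    have hsurj : Function.Surjective f := fun l => hcon l
    have := Fintype.card_le_of_surjective f hsurj
    simp only [Fintype.card_fin] at this
    omega
  set φ : (Fin n → ℤ) →ₗ[ℤ] ℤ := bM.coord l with hφ
  have hφN : ∀ x ∈ N, φ x = 0 := by
    intro x hx
    have hrepr := congrArg (fun z : N => (z : Fin n → ℤ)) (bN.sum_repr ⟨x, hx⟩)
    simp only [Submodule.coe_sum, Submodule.coe_smul] at hrepr
    rw [← hrepr, map_sum]
    refine Finset.sum_eq_zero fun i _ => ?_
    rw [map_smul, hsnf i, map_smul, hφ, Basis.coord_apply, Basis.repr_self, Finsupp.single_apply,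
      if_neg (fun h => hl ⟨i, h⟩), smul_zero, smul_zero]
  refine ⟨fun j => φ (Pi.single j 1), fun hv => ?_, fun χ hχ => ?_⟩
  · -- `φ ≠ 0` since `φ (bM l) = 1`
    have h1 : φ (bM l) = 1 := by rw [hφ, Basis.coord_apply, Basis.repr_self, Finsupp.single_eq_same]
    have h0 : φ (bM l) = 0 := by
      rw [pi_eq_sum_univ (bM l), map_sum]
      refine Finset.sum_eq_zero fun j _ => ?_
      have hj := congrFun hv j
      simp only [Pi.zero_apply] at hj
      have : (fun k : Fin n => if j = k then (1 : ℤ) else 0) = Pi.single j (1 : ℤ) := by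
        funext k
        by_cases h : j = k
        · subst h; simp
        · rw [if_neg h, Pi.single_eq_of_ne (Ne.symm h)]
      rw [map_smul, this, hj, smul_zero]
    rw [h0] at h1
    exact zero_ne_one h1
  · have hx : φ χ = 0 := hφN χ (by rw [hN]; exact hχ)
    rw [pi_eq_sum_univ χ, map_sum] at hx
    rw [← hx]
    refine Finset.sum_congr rfl fun j _ => ?_
    have : (fun k : Fin n => if j = k then (1 : ℤ) else 0) = Pi.single j (1 : ℤ) := by
      funext k
      by_cases h : j = k
      · subst h; simp
      · rw [if_neg h, Pi.single_eq_of_ne (Ne.symm h)]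
    rw [map_smul, this, smul_eq_mul]

/-- **Infinite case.** If `B ≤ ℤⁿ` has infinite index then `T_B` is infinite (it contains the
cocharacter `t ↦ (t^{v_j})_j` for an annihilating vector `v ≠ 0`). [cite: Borel1991, §8.5 Prop. 8.12] -/
theorem infinite_torsion_of_index_eq_zero (B : AddSubgroup (Fin n → ℤ)) (hB : B.index = 0) :
    Infinite {y : Fin n → ℂˣ // ∀ χ ∈ B, ∏ j, y j ^ χ j = 1} := by
  classical
  obtain ⟨v, hv0, hv⟩ := exists_annihilator_of_index_eq_zero B hB
  obtain ⟨j₀, hj₀⟩ : ∃ j₀, v j₀ ≠ 0 := by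
    by_contra h; push Not at h; exact hv0 (funext h)
  -- the cocharacter
  let c : ℂˣ → {y : Fin n → ℂˣ // ∀ χ ∈ B, ∏ j, y j ^ χ j = 1} := fun t =>
    ⟨fun j => t ^ v j, fun χ hχ => by
      simp only [← zpow_mul]
      rw [prod_zpow_eq_zpow_sum, show ∑ j, v j * χ j = ∑ j, χ j * v j from
        Finset.sum_congr rfl fun j _ => mul_comm _ _, hv χ hχ, zpow_zero]⟩
  haveI := infinite_units_complex
  -- every unit is the `j₀`-coordinate of some `c t`
  have hsurj : ∀ w : ℂˣ, ∃ t : ℂˣ, t ^ v j₀ = w := by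
    have key : ∀ (N : ℕ), N ≠ 0 → ∀ w : ℂˣ, ∃ t : ℂˣ, t ^ N = w := by
      intro N hN w
      obtain ⟨z, hz⟩ := IsAlgClosed.exists_pow_nat_eq (w : ℂ) (Nat.pos_of_ne_zero hN)
      have hz0 : z ≠ 0 := by
        rintro rfl
        rw [zero_pow hN] at hz
        exact w.ne_zero hz.symm
      exact ⟨Units.mk0 z hz0, Units.ext (by rw [Units.val_pow_eq_pow_val, Units.val_mk0, hz])⟩
    intro w
    obtain ⟨N, hN | hN⟩ := (v j₀).eq_nat_or_neg
    · have hN0 : N ≠ 0 := fun h => hj₀ (by rw [hN, h]; rfl)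
      obtain ⟨t, ht⟩ := key N hN0 w
      exact ⟨t, by rw [hN, zpow_natCast, ht]⟩
    · have hN0 : N ≠ 0 := fun h => hj₀ (by rw [hN, h]; rfl)
      obtain ⟨t, ht⟩ := key N hN0 w⁻¹
      exact ⟨t, by rw [hN, zpow_neg, zpow_natCast, ht, inv_inv]⟩
  refine ⟨fun hfin => ?_⟩
  have hfinS : (Set.range fun y : {y : Fin n → ℂˣ // ∀ χ ∈ B, ∏ j, y j ^ χ j = 1} =>
      (y : Fin n → ℂˣ) j₀).Finite := Set.finite_range _
  have huniv : (Set.range fun y : {y : Fin n → ℂˣ // ∀ χ ∈ B, ∏ j, y j ^ χ j = 1} =>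
      (y : Fin n → ℂˣ) j₀) = Set.univ := by
    refine Set.eq_univ_of_forall fun w => ?_
    obtain ⟨t, ht⟩ := hsurj w
    exact ⟨c t, ht⟩
  rw [huniv] at hfinS
  exact Set.infinite_univ hfinS

/-- **Torsion count = lattice index.** For every subgroup `B ≤ ℤⁿ`:
`#{y ∈ (ℂˣ)ⁿ ; y^χ = 1 ∀ χ ∈ B} = [ℤⁿ : B]` (`Nat.card` and `AddSubgroup.index`, both `0` when
infinite). [cite: Borel1991, §8.5 Prop. 8.12] -/
theorem natCard_torsion_eq_index (B : AddSubgroup (Fin n → ℤ)) :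
    Nat.card {y : Fin n → ℂˣ // ∀ χ ∈ B, ∏ j, y j ^ χ j = 1} = B.index := by
  by_cases hB : B.index = 0
  · haveI := infinite_torsion_of_index_eq_zero B hB
    rw [hB, Nat.card_eq_zero_of_infinite]
  · exact natCard_torsion_eq_index_of_ne_zero B hB

end GaGm

end Literature.NumberTheory.Transcendental
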